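/-
Copyright: derived here (Resolution Observatory cell `pub-rosobs`, carver gen 56). AI-written Lean; AI review is weaker than expert
review.  Companion file of the cell's POLYNOMIAL weighted-centre model `W(f)`: the algebraic core of engine 1's LEMMA PR″ ("the
parameter ray with power-series constants", THEOREM-FC-eng1-g37 §3; CARVER-NOTES-eng1-g37 T47): the INITIAL FORM along a weight with
non-negative support is a ring homomorphism on polynomial expressions, so the `ν`-leading part `A^♭` of a graded isotropy `A` is again
an isotropy.
Instrument — NOT a resolution theorem and NOT a statement about the invariant of [AbramovichTemkinWlodarczyk2024].
-/
import Mathlib.RingTheory.MvPolynomial.WeightedHomogeneous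
import Mathlib.Algebra.MvPolynomial.Rename
import Mathlib.Algebra.MvPolynomial.CommRing
import Mathlib.Algebra.Order.Monoid.Defs
import Mathlib.Data.Nat.GCD.Basic
import Mathlib.Tactic.Ring
import HarnessLib

/-!
# LEMMA PR″, algebraic core: the weight-zero initial form of an isotropy is an isotropy

Engine 1's LEMMA PR″ (THEOREM-FC-eng1-g37 §3) takes a graded isotropy `Θ : ε ↦ ε + A(τ, ε)` of `g ∈ k[ε]` with constants in
`R = k[[s]]` (or `k[s]`), puts `ν := min v_s(b)/S` over the terms `b τ^S ε^μ` of `A`, and passes to the `ν`-LEADING PART `A^♭` (the terms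
with `v_s(b) = ν S`) by the rescaling `s ↦ κ^{s*} s, τ ↦ κ^{−r} τ` followed by `κ ↦ 0`.  The present file types the same move WITHOUT
`κ` and without Laurent polynomials, as graded algebra in ONE multivariate polynomial ring `MvPolynomial σ R` (all of `s`, `τ`, `ε_i` are
variables of `σ`; `R = k`):

* fix a weight `w : σ → M` into a linearly ordered cancellative monoid (engine: `M = ℚ`, `w s = 1`, `w τ = −ν`, `w ε_i = 0`; or `M = ℤ`
  after multiplying by `s*`); `SupportedGE w m F` says every monomial of `F` has weight `≥ m` (engine: `A_i` is supported in weights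
  `n − ν S ≥ 0` BY THE CHOICE of `ν` as a minimum), and Mathlib's `weightedHomogeneousComponent w 0 F` is the weight-`0` part
  (engine: `A^♭_i = weightedHomogeneousComponent w 0 A_i` — the terms with `n = ν S`);
* `weightedHomogeneousComponent_mul_of_supportedGE` : for `F` supported in weights `≥ m` and `G` in weights `≥ n`, the weight-`(m+n)`
  part of `F G` is the product of the weight-`m` part of `F` and the weight-`n` part of `G` (initial forms multiply on the non-negative
  cone — the content of the `κ`-trick; NO cancellation issue because the cut-off weight is FIXED, not "the least weight present");
* `supportedGE_aeval` : hence on polynomial expressions `g(B_1, …, B_r)` in non-negatively supported `B_i` the weight-`0` part is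
  `g(B_1^♭, …, B_r^♭)` (a ring homomorphism on the non-negative cone);
* **`isotropy_initialForm`** (PR″ core): if `g(ε + A) = g(ε) + D` with every `A_i` non-negatively supported, the slot variables of
  weight `0`, and `D` without weight-`0` part (exact isotropy: `D = 0`, `isotropy_initialForm'`; the remainder `D` lets the engine truncate
  power-series constants `t(s)` modulo `s^T` — then `D ∈ (s^T)` has no weight-`0` monomial as soon as `T > ν · (τ-degree bound)`), then
  `g(ε + A^♭) = g(ε)` EXACTLY;
* bookkeeping: `A^♭ ≠ 0` as soon as one term attains the minimum (`weightedHomogeneousComponent_ne_zero_of_coeff`), `A^♭` keeps every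
  vanishing pattern of coefficients of `A` (`coeff_ne_zero_of_weightedHomogeneousComponent`; e.g. "no pure term on the slots of weight
  `≤ w₀`") and every OTHER grading (`IsWeightedHomogeneous.weightedHomogeneousComponent_of_supported`: gradedness by slot weights is
  preserved), and the exponent arithmetic of the new parameter `σ′ = τ^{s*} s^{r}` (`exponent_of_weight_zero`: `s* n = r S`,
  `gcd(s*, r) = 1` ⇒ `s* ∣ S` and `n = r (S/s*)`, i.e. `s^n τ^S = σ′^{S/s*}`).

NOT here (engine's modelling / informal bookkeeping): power series in `s` (`MvPowerSeries`), the choice of `ν` as a minimum, the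
re-parametrisation map `k[σ′] → k[s, τ]` and its injectivity, degrees of parameters.

Pattern cite [cite: Eisenbud1995, §15.8] (initial forms with respect to a weight order; `in_w(fg) = in_w(f) in_w(g)`); formalisation and
statements ours, elementary.
-/

namespace Literature.AlgebraicGeometry.Resolution.WeightedBlowup

namespace ParameterRay

open MvPolynomial Finsupp

variable {σ R M : Type*} [CommSemiring R] [AddCommMonoid M]
variable {w : σ → M}

section Preorder

variable [Preorder M]

/-! ## Support in weights `≥ m` -/

/-- `F` is supported in `w`-weights `≥ m`: every monomial with a non-zero coefficient has weight at least `m` (ours).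
[cite: Eisenbud1995, §15.8] -/
def SupportedGE (w : σ → M) (m : M) (F : MvPolynomial σ R) : Prop :=
  ∀ d : σ →₀ ℕ, coeff d F ≠ 0 → m ≤ weight w d

/-- `0` is supported anywhere (plumbing). [cite: Eisenbud1995, §15.8] -/
theorem supportedGE_zero (m : M) : SupportedGE w m (0 : MvPolynomial σ R) :=
  fun d h => (h (coeff_zero d)).elim

/-- Monotonicity in the cut-off (plumbing). [cite: Eisenbud1995, §15.8] -/
theorem SupportedGE.of_le {m m' : M} {F : MvPolynomial σ R} (hF : SupportedGE w m F) (h : m' ≤ m) :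
    SupportedGE w m' F :=
  fun d hd => h.trans (hF d hd)

/-- Sums (plumbing). [cite: Eisenbud1995, §15.8] -/
theorem SupportedGE.add {m : M} {F G : MvPolynomial σ R} (hF : SupportedGE w m F) (hG : SupportedGE w m G) :
    SupportedGE w m (F + G) := by
  intro d hd
  rw [coeff_add] at hd
  by_cases hF0 : coeff d F = 0
  · rw [hF0, zero_add] at hd
    exact hG d hd
  · exact hF d hF0

/-- Constants are supported in weight `≥ 0` (plumbing). [cite: Eisenbud1995, §15.8] -/
theorem supportedGE_C (r : R) : SupportedGE w 0 (C r : MvPolynomial σ R) := by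
  classical
  intro d hd
  rw [coeff_C] at hd
  split_ifs at hd with h
  · rw [← h, map_zero]
  · exact (hd rfl).elim

/-- A variable of weight `≥ m` is supported in weight `≥ m` (plumbing). [cite: Eisenbud1995, §15.8] -/
theorem supportedGE_X {m : M} (i : σ) (h : m ≤ w i) : SupportedGE w m (X i : MvPolynomial σ R) := by
  classical
  intro d hd
  rw [coeff_X] at hd
  split_ifs at hd with hi
  · rw [← hi, weight_single, one_nsmul]
    exact h
  · exact (hd rfl).elim

/-- Below the cut-off there is nothing (plumbing). [cite: Eisenbud1995, §15.8] -/
theorem SupportedGE.weightedHomogeneousComponent_eq_zero {m n : M} {F : MvPolynomial σ R} (hF : SupportedGE w m F)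
    (h : n < m) : weightedHomogeneousComponent w n F = 0 :=
  weightedHomogeneousComponent_eq_zero' n F fun d hd hn =>
    (lt_irrefl n) (lt_of_lt_of_le h (hn ▸ hF d (MvPolynomial.mem_support_iff.mp hd)))

end Preorder

section WeightZero

/-- A weight-`0` variable is its own weight-`0` component (plumbing). [cite: Eisenbud1995, §15.8] -/
theorem weightedHomogeneousComponent_X_of_eq_zero {i : σ} (h : w i = 0) :
    weightedHomogeneousComponent w 0 (X i : MvPolynomial σ R) = X i := by
  have hX := isWeightedHomogeneous_X R w i
  rw [h] at hX
  exact hX.weightedHomogeneousComponent_same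


end WeightZero

section Cancel

variable [LinearOrder M] [IsOrderedCancelAddMonoid M]

/-! ## Initial forms multiply on the non-negative cone -/

/-- Products: weights add (derived here). [cite: Eisenbud1995, §15.8] -/
theorem SupportedGE.mul {m n : M} {F G : MvPolynomial σ R} (hF : SupportedGE w m F) (hG : SupportedGE w n G) :
    SupportedGE w (m + n) (F * G) := by
  classical
  intro d hd
  rw [coeff_mul] at hd
  obtain ⟨x, hx, hne⟩ := Finset.exists_ne_zero_of_sum_ne_zero hd
  have hF0 : coeff x.1 F ≠ 0 := fun h => hne (by rw [h, zero_mul])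
  have hG0 : coeff x.2 G ≠ 0 := fun h => hne (by rw [h, mul_zero])
  rw [← Finset.mem_antidiagonal.mp hx, map_add]
  exact add_le_add (hF _ hF0) (hG _ hG0)


/-- **Initial forms multiply** (derived here): for `F` supported in weights `≥ m` and `G` in weights `≥ n`, the weight-`(m + n)`
component of `F G` is the product of the weight-`m` component of `F` and the weight-`n` component of `G`.
[cite: Eisenbud1995, §15.8] -/
theorem weightedHomogeneousComponent_mul_of_supportedGE {m n : M} {F G : MvPolynomial σ R} (hF : SupportedGE w m F)
    (hG : SupportedGE w n G) :
    weightedHomogeneousComponent w (m + n) (F * G) =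
      weightedHomogeneousComponent w m F * weightedHomogeneousComponent w n G := by
  classical
  ext d
  rw [coeff_weightedHomogeneousComponent, coeff_mul, coeff_mul]
  split_ifs with hd
  · refine Finset.sum_congr rfl fun x hx => ?_
    rw [coeff_weightedHomogeneousComponent, coeff_weightedHomogeneousComponent]
    by_cases hF0 : coeff x.1 F = 0
    · rw [hF0]; split_ifs <;> simp
    by_cases hG0 : coeff x.2 G = 0
    · rw [hG0]; split_ifs <;> simp
    have h1 : m ≤ weight w x.1 := hF _ hF0
    have h2 : n ≤ weight w x.2 := hG _ hG0
    have hsum : weight w x.1 + weight w x.2 = m + n := by rw [← map_add, Finset.mem_antidiagonal.mp hx, hd]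
    have e1 : weight w x.1 = m := by
      refine le_antisymm (not_lt.mp fun hlt => ?_) h1
      exact absurd hsum (ne_of_gt (add_lt_add_of_lt_of_le hlt h2))
    have e2 : weight w x.2 = n := by
      refine le_antisymm (not_lt.mp fun hlt => ?_) h2
      exact absurd hsum (ne_of_gt (add_lt_add_of_le_of_lt h1 hlt))
    rw [if_pos e1, if_pos e2]
  · symm
    refine Finset.sum_eq_zero fun x hx => ?_
    rw [coeff_weightedHomogeneousComponent, coeff_weightedHomogeneousComponent]
    split_ifs with h1 h2
    · exact absurd (by rw [← Finset.mem_antidiagonal.mp hx, map_add, h1, h2]) hd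
    all_goals simp

/-- **The weight-`0` part is a ring homomorphism on polynomial expressions in non-negatively supported arguments** (derived here):
`g(B)` is non-negatively supported and its weight-`0` component is `g(B^♭)`, `B^♭_i :=` the weight-`0` component of `B_i`.
[cite: Eisenbud1995, §15.8] -/
theorem supportedGE_aeval {ι : Type*} (g : MvPolynomial ι R) (B : ι → MvPolynomial σ R) (hB : ∀ i, SupportedGE w 0 (B i)) :
    SupportedGE w 0 (aeval B g) ∧
      weightedHomogeneousComponent w 0 (aeval B g) = aeval (fun i => weightedHomogeneousComponent w 0 (B i)) g := by
  induction g using MvPolynomial.induction_on with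
  | C r =>
    rw [aeval_C, aeval_C, algebraMap_eq]
    exact ⟨supportedGE_C r, (isWeightedHomogeneous_C w r).weightedHomogeneousComponent_same⟩
  | add p q hp hq =>
    rw [map_add, map_add, map_add]
    exact ⟨hp.1.add hq.1, by rw [hp.2, hq.2]⟩
  | mul_X p i hp =>
    have hs := hp.1.mul (hB i)
    have hm := weightedHomogeneousComponent_mul_of_supportedGE hp.1 (hB i)
    rw [add_zero] at hs hm
    rw [map_mul (aeval B), map_mul (aeval fun i => weightedHomogeneousComponent w 0 (B i)), aeval_X, aeval_X]
    exact ⟨hs, by rw [hm, hp.2]⟩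

/-- `rename` along weight-`0` variables is fixed by the weight-`0` component (plumbing). [cite: Eisenbud1995, §15.8] -/
theorem weightedHomogeneousComponent_rename {ι : Type*} (e : ι → σ) (he : ∀ i, w (e i) = 0) (g : MvPolynomial ι R) :
    weightedHomogeneousComponent w 0 (rename e g) = rename e g := by
  have h := (supportedGE_aeval g (fun i => (X (e i) : MvPolynomial σ R)) fun i => supportedGE_X (e i) (he i).ge).2
  rw [rename_eq_aeval]
  change weightedHomogeneousComponent w 0 (aeval (fun i => (X (e i) : MvPolynomial σ R)) g) =
    aeval (fun i => (X (e i) : MvPolynomial σ R)) g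
  have hf : (fun i => weightedHomogeneousComponent w 0 (X (e i) : MvPolynomial σ R)) = fun i => X (e i) :=
    funext fun i => weightedHomogeneousComponent_X_of_eq_zero (he i)
  rw [h, hf]

/-! ## PR″ core: the initial form of an isotropy is an isotropy -/

/-- **LEMMA PR″, algebraic core** (derived here): let the slot variables `e i` have weight `0`, let every shift `A_i` be supported in
weights `≥ 0`, and suppose `g(ε + A) = g(ε) + D` where `D` has NO weight-`0` component.  Then the weight-`0` parts
`A^♭_i := weightedHomogeneousComponent w 0 A_i` satisfy `g(ε + A^♭) = g(ε)` exactly. [cite: Eisenbud1995, §15.8] -/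
theorem isotropy_initialForm {ι : Type*} (g : MvPolynomial ι R) (e : ι → σ) (he : ∀ i, w (e i) = 0)
    (A : ι → MvPolynomial σ R) (hA : ∀ i, SupportedGE w 0 (A i)) (D : MvPolynomial σ R)
    (hD : weightedHomogeneousComponent w 0 D = 0)
    (hiso : aeval (fun i => X (e i) + A i) g = rename e g + D) :
    aeval (fun i => X (e i) + weightedHomogeneousComponent w 0 (A i)) g = rename e g := by
  have hB : ∀ i, SupportedGE w 0 (X (e i) + A i) := fun i => (supportedGE_X (e i) (he i).ge).add (hA i)
  have h := (supportedGE_aeval g _ hB).2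
  rw [hiso, map_add, hD, add_zero, weightedHomogeneousComponent_rename e he] at h
  have hf : (fun i => weightedHomogeneousComponent w 0 (X (e i) + A i)) =
      fun i => X (e i) + weightedHomogeneousComponent w 0 (A i) :=
    funext fun i => by rw [map_add, weightedHomogeneousComponent_X_of_eq_zero (he i)]
  rw [h, hf]

/-- Exact version: `g(ε + A) = g(ε)` ⇒ `g(ε + A^♭) = g(ε)` (derived here). [cite: Eisenbud1995, §15.8] -/
theorem isotropy_initialForm' {ι : Type*} (g : MvPolynomial ι R) (e : ι → σ) (he : ∀ i, w (e i) = 0)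
    (A : ι → MvPolynomial σ R) (hA : ∀ i, SupportedGE w 0 (A i))
    (hiso : aeval (fun i => X (e i) + A i) g = rename e g) :
    aeval (fun i => X (e i) + weightedHomogeneousComponent w 0 (A i)) g = rename e g :=
  isotropy_initialForm g e he A hA 0 (map_zero _) (by rw [hiso, add_zero])

/-- The shifted substitution `g(ε + A)` is itself supported in weights `≥ 0`, so a remainder `D = g(ε + A) − g(ε)` is, too
(plumbing for the truncation remark). [cite: Eisenbud1995, §15.8] -/
theorem supportedGE_aeval_shift {ι : Type*} (g : MvPolynomial ι R) (e : ι → σ) (he : ∀ i, w (e i) = 0)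
    (A : ι → MvPolynomial σ R) (hA : ∀ i, SupportedGE w 0 (A i)) :
    SupportedGE w 0 (aeval (fun i => X (e i) + A i) g) :=
  (supportedGE_aeval g _ fun i => (supportedGE_X (e i) (he i).ge).add (hA i)).1

end Cancel

section Bookkeeping

/-! ## Bookkeeping: non-triviality, inherited vanishing patterns and gradings, the exponents of `σ′` -/

/-- `A^♭ ≠ 0` as soon as one monomial of `A` has weight exactly `m` (engine: a term attaining the minimum `ν`; derived here).
[cite: Eisenbud1995, §15.8] -/
theorem weightedHomogeneousComponent_ne_zero_of_coeff {m : M} {F : MvPolynomial σ R} {d : σ →₀ ℕ} (hd : weight w d = m)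
    (hF : coeff d F ≠ 0) : weightedHomogeneousComponent w m F ≠ 0 := by
  classical
  intro h
  apply hF
  have hc := congrArg (coeff d) h
  rwa [coeff_weightedHomogeneousComponent, if_pos hd, coeff_zero] at hc

/-- A non-zero coefficient of `A^♭` is a non-zero coefficient of `A` of the right weight (plumbing: `A^♭` inherits every vanishing
pattern of `A`, e.g. "no pure term on the slots of weight `≤ w₀`"). [cite: Eisenbud1995, §15.8] -/
theorem coeff_ne_zero_of_weightedHomogeneousComponent {m : M} {F : MvPolynomial σ R} {d : σ →₀ ℕ}
    (h : coeff d (weightedHomogeneousComponent w m F) ≠ 0) : coeff d F ≠ 0 ∧ weight w d = m := by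
  classical
  rw [coeff_weightedHomogeneousComponent] at h
  split_ifs at h with hd
  · exact ⟨h, hd⟩
  · exact (h rfl).elim

/-- `A^♭` stays homogeneous for any OTHER weight `w'` for which `A` is (engine: gradedness by the slot weights is preserved; derived
here). [cite: Eisenbud1995, §15.8] -/
theorem _root_.MvPolynomial.IsWeightedHomogeneous.weightedHomogeneousComponent_of_supported {M' : Type*} [AddCommMonoid M']
    {w' : σ → M'} {n : M'} {m : M} {F : MvPolynomial σ R} (hF : IsWeightedHomogeneous w' F n) :
    IsWeightedHomogeneous w' (weightedHomogeneousComponent w m F) n :=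
  fun _ hd => hF (coeff_ne_zero_of_weightedHomogeneousComponent hd).1

/-- The exponents of the new parameter `σ′ = τ^{s*} s^{r}` (engine (iii); derived here): a weight-`0` monomial `s^n τ^S`, i.e.
`s* · n = r · S` with `gcd(s*, r) = 1`, has `s* ∣ S` and `n = r · (S / s*)`, so `s^n τ^S = σ′^{S/s*}`. [cite: Eisenbud1995, §15.8] -/
theorem exponent_of_weight_zero {sStar r n S : ℕ} (hs : 0 < sStar) (hco : Nat.Coprime sStar r) (h : sStar * n = r * S) :
    sStar ∣ S ∧ n = r * (S / sStar) := by
  have hS : sStar ∣ S := hco.dvd_of_dvd_mul_left ⟨n, by rw [h]⟩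
  refine ⟨hS, ?_⟩
  obtain ⟨q, hq⟩ := hS
  rw [hq, Nat.mul_div_cancel_left q hs]
  rw [hq] at h
  exact Nat.eq_of_mul_eq_mul_left hs (by rw [h]; ring)

end Bookkeeping

end ParameterRay

end Literature.AlgebraicGeometry.Resolution.WeightedBlowup
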